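import Mathlib.AlgebraicGeometry.AlgClosed.Basic
import Mathlib.AlgebraicGeometry.Morphisms.Proper
import Mathlib.AlgebraicGeometry.Morphisms.Smooth
import Mathlib.AlgebraicGeometry.Morphisms.Separated
import Mathlib.AlgebraicGeometry.ProjectiveSpectrum.Basic
import Mathlib.AlgebraicGeometry.ProjectiveSpectrum.Proper
import Mathlib.AlgebraicGeometry.AffineSpace
import Mathlib.RingTheory.MvPolynomial.Homogeneous
import Mathlib.Analysis.Complex.Polynomial.Basic
import Mathlib.Analysis.Analytic.Polynomial
import Mathlib.Geometry.Manifold.MFDeriv.Defs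
import Mathlib.Geometry.Manifold.MFDeriv.FDeriv
import Mathlib.Topology.Algebra.MvPolynomial
import Mathlib.Topology.Homeomorph.Defs
import Literature.AlgebraicGeometry.Motives.Varieties
import Literature.AlgebraicGeometry.Motives.AlgPoints
import Literature.NumberTheory.Transcendental.ProjectiveSpace
import HarnessLib

-- provenance: harness21/H21/H21/Prelude/TranscendKaehlerL/Analytification.lean @ 7095ce4 (interim HEAD d8f2665); M5 mechanical rewrite
/-!
# Analytification of a `ℂ`-scheme (trunk TranscendKaehlerL, item C14)

Let `X` be a scheme locally of finite type over a subfield `k ⊆ ℂ` (in Lean: `X : Literature.SchemeOver k`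
with `[Algebra k ℂ]`; the main case is `k = ℂ`). The set of complex points `X(ℂ)` with its
*analytic* (strong, classical) topology is the accepted `Literature.ComplexPoints X = Literature.AlgPoints X ℂ`
of `Literature.AlgebraicGeometry.Motives.AlgPoints` (topology `AlgPoints.instTopologicalSpace`, generated by
the sets `{P ∈ U(ℂ) | s(P) ∈ V}`; functoriality `AlgPoints.map`, `AlgPoints.continuous_map`;
`t2Space_algPoints`, `compactSpace_algPoints_of_isProper`, `locallyCompactSpace_algPoints`,
`nonempty_algPoints_affineSpace_homeomorph`). **This file does not introduce a second type or
topology** (interop contract of `Outlines/MotiveAbstract.md` §10); it adds, on top of `AlgPoints`: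

* the bridge to Mathlib's `AlgebraicGeometry.pointEquivClosedPoint` for `k = ℂ`
  (`ComplexPoints.isClosed_pt`, `ComplexPoints.homEquiv`, `ComplexPoints.equivClosedPoints`,
  `ComplexPoints.resHom_eq`, `ComplexPoints.eval_eq` — all proved);
* small point-set API valid for any topological field `L` (`AlgPoints.evalOrZero`, a total version
  of `AlgPoints.eval` with junk value `0`; `AlgPoints.isOpen_setOf_pt_mem`;
  `AlgPoints.continuousOn_evalOrZero`; `AlgPoints.isOpenEmbedding_map`);
* the GAGA-type comparison facts `ComplexPoints.t2Space_iff_isSeparated`,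
  `ComplexPoints.compactSpace_iff_isProper`, `ComplexPoints.secondCountableTopology_of_compactSpace`,
  `ComplexPoints.connectedSpace_iff` [SGA1 XII Prop. 2.4, 3.1, 3.2; Serre GAGA §2 Prop. 6];
* the predicate `Literature.IsAnalytification E X d φ`: a map `φ : M → X(ℂ)` from a complex charted
  space `M` modelled on `E` exhibits `M` as the analytification `X^an` of the smooth `k`-scheme `X`
  of relative dimension `d` (`φ` is a homeomorphism, `finrank ℂ E = d`, regular functions pull
  back to holomorphic functions), with existence (`exists_isAnalytification`), uniqueness up to
  biholomorphism among holomorphic atlases (`IsAnalytification.unique`), functoriality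
  (`IsAnalytification.mdifferentiable_comp_map`) [Serre GAGA §§1–2; SGA1 XII §1];
* the examples `exists_isAnalytification_affineSpace` (`ℂᵈ = 𝔸ᵈ(ℂ)^an`) and
  `exists_isAnalytification_proj` (`ℙⁿ(ℂ)`, with the standard atlas of
  `Literature.NumberTheory.Transcendental.ProjectiveSpace`, is the analytification of the accepted
  `Literature.projectiveSpace n ℂ` of `Literature.AlgebraicGeometry.Motives.Varieties`), together with
  the real instance `IsProper (projectiveSpace n k).hom` (via `𝒜 0 ≃ k`).
* the proof `exists_isAnalytification_affineSpace_holds` of the first example [Serre, GAGA §2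
  n°5, Lemme 1 & Prop. 2], with its supporting API: `AlgPoints.affinePoint`,
  `AlgPoints.affineCoords`, `AlgPoints.affinePointEquiv` (`L`-points of `𝔸^σ_k` are `L^σ`; the
  value of a global function at `w` is polynomial evaluation, `AlgPoints.eval_top_affinePoint`;
  regular functions are locally of the form `p / gⁿ`,
  `AlgPoints.exists_evalOrZero_affinePoint_eq_div`), `affineSpaceGlobalSectionsIso`
  (`Γ(𝔸ⁿ_R, ⊤) ≅ R[xᵢ]`), `ComplexPoints.differentiableOn_evalOrZero_affinePoint` (regular
  functions on `𝔸ᵈ_ℂ` are holomorphic) and `ComplexPoints.affineHomeomorph` (`ℂᵈ ≃ₜ 𝔸ᵈ(ℂ)`).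

## Mathlib

Used as is: `pointEquivClosedPoint`, `residueFieldIsoBase`, `Scheme.SpecToEquivOfField`,
`Scheme.evaluation`, `SmoothOfRelativeDimension`, `IsProper`, `IsSeparated`,
`LocallyOfFiniteType`, `Proj`, `Proj.toSpecZero`, `Proj.basicOpen`, `AffineSpace` (`𝔸(n; S)`,
`AffineSpace.coord`), `MvPolynomial.homogeneousSubmodule`, `IsManifold`, `MDifferentiableOn`.
Mathlib has no topology on `ℂ`-points and no analytification (searched `analytification`,
`ComplexPoints`, `TopologicalSpace.*Spec`). Mathlib gap met: there is no
`IsScalarTower S (A 0) R` instance for a graded `S`-algebra `R` (searched `GradedMonoid`,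
`GradedAlgebra/Basic`, `DirectSum/Internal`); we add `Literature.NumberTheory.Transcendental.isScalarTower_gradeZero`.

## Design

* Where a statement holds for `X` over any subfield `k ⊆ ℂ` (Hausdorff ↔ separated,
  compact ↔ proper, second countability, the `IsAnalytification` theory) it is stated in that
  generality, since `Literature.AlgebraicGeometry.Motives.BettiRealization` uses `ComplexPoints X` for
  `X` over `k ⊆ ℂ`; here `X(ℂ) = X_ℂ(ℂ)` as topological spaces and the algebraic properties descend
  along `Spec ℂ → Spec k`. The Nullstellensatz bridge (`isClosed_pt`, `equivClosedPoints`) and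
  `connectedSpace_iff` are specific to `k = ℂ` (`Spec ℚ(i)` is connected with two complex points).
* `AlgPoints.evalOrZero U s P` is total in `P`, with junk value `0` when `P.pt ∉ U`; only its
  restriction to `U(ℂ) = {P | P.pt ∈ U}` is meaningful (`AlgPoints.basicSet_eq_setOf`).
* `IsAnalytification` records only a `ChartedSpace` structure on `M`; uniqueness up to
  biholomorphism (via Osgood/Hartogs) needs holomorphic atlases, so `IsAnalytification.unique`
  and `mdifferentiable_comp_map` assume `[IsManifold 𝓘(ℂ, E) ω M]` on both sides. Following the
  outline, `E` carries `[FiniteDimensional ℂ E]` and the structure records `finrank ℂ E = d`.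
  Smoothness `[SmoothOfRelativeDimension d X.hom]` is a hypothesis of the theorems, not a
  parameter of the predicate (no field uses it; consumers add it themselves). For singular `X`
  the predicate is not the right notion (`X^an` is not a manifold).
* `compactSpace_iff_isProper` assumes `[IsSeparated X.hom]` (SGA1 XII Prop. 3.2): the projective
  line with a doubled origin has compact non-Hausdorff `X(ℂ)` (a Lean `CompactSpace`) but is not
  proper. The unconditional half proper ⇒ compact is `Literature.compactSpace_algPoints_of_isProper X ℂ`
  (accepted, in `AlgPoints`).
* `secondCountableTopology_of_compactSpace` assumes `[CompactSpace X.left]`, i.e. the underlying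
  space of the *scheme* is quasi-compact (so `X` is of finite type): a scheme locally of finite
  type with uncountably many connected components has non-second-countable `X(ℂ)`.
* Instance-shaped facts with deferred proofs are `theorem`s; use `haveI`.

## References

* J.-P. Serre, *Géométrie algébrique et géométrie analytique*, Ann. Inst. Fourier **6** (1956),
  §§1–2, Prop. 6.
* A. Grothendieck, M. Raynaud, *SGA 1*, Exposé XII, §1, Prop. 2.4, Prop. 3.1, Prop. 3.2.
* R. Hartshorne, *Algebraic Geometry*, II §§2–4, III §10, Appendix B.
* D. Mumford, *The Red Book of Varieties and Schemes*, I §10.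
-/

noncomputable section

universe u

open CategoryTheory AlgebraicGeometry Topology
open scoped Manifold ContDiff LinearAlgebra.Projectivization

namespace Literature.NumberTheory.Transcendental

/-! ### Point-set API for `AlgPoints` (any topological field `L`) -/

section AlgPoints
open Literature.AlgebraicGeometry.Motives (AlgPoints)
open Literature.AlgebraicGeometry.Motives.AlgPoints

variable {k : Type u} [Field k] {X Y : Literature.AlgebraicGeometry.Motives.SchemeOver k} {L : Type u} [Field L] [Algebra k L]

open Classical in
/-- The value `f(P) ∈ L` of a regular function `f ∈ Γ(X, U)` at an `L`-point `P`, as a *total*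
function of `P`: `P.eval U h f` if `h : P.pt ∈ U`, junk value `0` otherwise. Only its restriction
to `U(L) = {P | P.pt ∈ U}` is meaningful. [Mumford, *Red Book* I §10; Serre, GAGA §2] [folklore] -/
def _root_.Literature.AlgebraicGeometry.Motives.AlgPoints.evalOrZero (U : X.left.Opens) (f : Γ(X.left, U)) (P : AlgPoints X L) : L :=
  if h : P.pt ∈ U then P.eval U h f else 0

/-- On `U(L)`, `evalOrZero` is `AlgPoints.eval`. [Mumford, *Red Book* I §10] [folklore] -/
theorem _root_.Literature.AlgebraicGeometry.Motives.AlgPoints.evalOrZero_of_mem {U : X.left.Opens} (f : Γ(X.left, U)) {P : AlgPoints X L}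
    (h : P.pt ∈ U) : evalOrZero U f P = P.eval U h f :=
  dif_pos h

/-- The junk value of `evalOrZero` off `U(L)`. [Mumford, *Red Book* I §10] [folklore] -/
theorem _root_.Literature.AlgebraicGeometry.Motives.AlgPoints.evalOrZero_of_not_mem {U : X.left.Opens} (f : Γ(X.left, U)) {P : AlgPoints X L}
    (h : P.pt ∉ U) : evalOrZero U f P = 0 :=
  dif_neg h

/-- The subbasic sets of the strong topology in terms of the total evaluation:
`basicSet U f V = {P | P.pt ∈ U ∧ evalOrZero U f P ∈ V}`. [Mumford, *Red Book* I §10] [folklore] -/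
theorem _root_.Literature.AlgebraicGeometry.Motives.AlgPoints.basicSet_eq_setOf (U : X.left.Opens) (f : Γ(X.left, U)) (V : Set L) :
    basicSet U f V = {P : AlgPoints X L | P.pt ∈ U ∧ evalOrZero U f P ∈ V} := by
  ext P
  constructor
  · rintro ⟨h, hV⟩
    exact ⟨h, by rwa [evalOrZero_of_mem f h]⟩
  · rintro ⟨h, hV⟩
    exact ⟨h, by rwa [evalOrZero_of_mem f h] at hV⟩

variable [TopologicalSpace L]

/-- `U(L) ⊆ X(L)` is open in the strong topology (it is `basicSet U 0 univ`).
[Mumford, *Red Book* I §10; SGA1 XII §1] [folklore] -/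
theorem _root_.Literature.AlgebraicGeometry.Motives.AlgPoints.isOpen_setOf_pt_mem (U : X.left.Opens) : IsOpen {P : AlgPoints X L | P.pt ∈ U} := by
  convert isOpen_basicSet (X := X) (L := L) U 0 isOpen_univ using 1
  ext P
  simp [basicSet]

/-- Regular functions are continuous on `U(L)` for the strong topology (by construction).
[Serre, GAGA §2; Mumford, *Red Book* I §10] [folklore] -/
theorem _root_.Literature.AlgebraicGeometry.Motives.AlgPoints.continuousOn_evalOrZero (U : X.left.Opens) (f : Γ(X.left, U)) :
    ContinuousOn (evalOrZero U f) {P : AlgPoints X L | P.pt ∈ U} := by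
  rw [continuousOn_open_iff (isOpen_setOf_pt_mem U)]
  intro V hV
  convert isOpen_basicSet (X := X) (L := L) U f hV using 1
  rw [basicSet_eq_setOf]
  rfl

/-- Global regular functions are continuous on all of `X(L)`. [Mumford, *Red Book* I §10] [folklore] -/
theorem _root_.Literature.AlgebraicGeometry.Motives.AlgPoints.continuous_evalOrZero_top (f : Γ(X.left, ⊤)) :
    Continuous (evalOrZero ⊤ f : AlgPoints X L → L) := by
  rw [← continuousOn_univ]
  convert continuousOn_evalOrZero (X := X) (L := L) ⊤ f
  simp

/-- An open immersion of `k`-schemes induces an open embedding `U(L) ↪ X(L)` on `L`-points (its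
image is `{P | P.pt ∈ U}` and opens/regular functions of `U` are opens/regular functions of `X`).
This is the point-set content of SGA1 XII Thm. 1.1, proof, step a) (`X^an = ψ⁻¹(X)` open in
`Y^an` with the induced structure, for `X ⊆ Y` an open subscheme) and the easy direction of
SGA1 XII Prop. 3.1 (xi) (`f` open immersion `⇒ f^an` open immersion); it holds for every
topological `L`. Proved below: `isOpenEmbedding_map_holds`.
[SGA1 XII Thm. 1.1 a), Prop. 3.1 (xi); Serre, GAGA §2] [cite: SGA1, Exp. XII Prop. 3.1 (xi)]
[cite: SGA1, Exp. XII Thm. 1.1, proof a)] -/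
def _root_.Literature.AlgebraicGeometry.Motives.AlgPoints.isOpenEmbedding_map : Prop :=
  ∀ (φ : X ⟶ Y) [IsOpenImmersion φ.left],
    IsOpenEmbedding (map φ : AlgPoints X L → AlgPoints Y L)

/-- The image of `U(L) ↪ X(L)` for an open immersion `U ⟶ X` is `{P | P.pt ∈ U}` (a morphism
`Spec L → X` landing in `U` factors uniquely through `U`). Proved below:
`range_map_of_isOpenImmersion_holds`.
[SGA1 XII §1, Thm. 1.1 proof a)] [cite: SGA1, Exp. XII Thm. 1.1, proof a)] -/
def _root_.Literature.AlgebraicGeometry.Motives.AlgPoints.range_map_of_isOpenImmersion : Prop :=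
  ∀ (φ : X ⟶ Y) [IsOpenImmersion φ.left],
    Set.range (map φ : AlgPoints X L → AlgPoints Y L) = {Q | Q.pt ∈ φ.left.opensRange}

end AlgPoints

/-- The structure morphism of `Spec k` as a `k`-scheme is the identity
(`algebraMap k k = id`). [Hartshorne II §2] [folklore] -/
theorem specOver_self_hom (k : Type u) [Field k] : (Literature.AlgebraicGeometry.Motives.specOver k k).hom = 𝟙 (Spec (.of k)) := by
  change Spec.map (CommRingCat.ofHom (algebraMap k k)) = _
  rw [Algebra.algebraMap_self, CommRingCat.ofHom_id, Spec.map_id]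

section ComplexPoints
open Literature.AlgebraicGeometry.Motives (ComplexPoints)

/-! ### Complex points of a `ℂ`-scheme: the Nullstellensatz bridge to Mathlib -/

section OverComplex

variable {X : Literature.AlgebraicGeometry.Motives.SchemeOver ℂ}

/-- A complex point of a `ℂ`-scheme is a section of the structure morphism:
`P ≫ (X → Spec ℂ) = 𝟙`. This is the condition in Mathlib's `pointEquivClosedPoint`.
[Hartshorne II Ex. 2.7] [folklore] -/
theorem _root_.Literature.AlgebraicGeometry.Motives.ComplexPoints.toSpecHom_comp_hom (P : ComplexPoints X) : P.toSpecHom ≫ X.hom = 𝟙 _ := by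
  rw [← specOver_self_hom ℂ]
  exact Over.w P

/-- The underlying point of a complex point of a `ℂ`-scheme is a closed point (a section of the
separated morphism `Spec ℂ ⟶ Spec ℂ` is a closed immersion). Proof as in Mathlib
`pointEquivClosedPoint`. [Hartshorne II Ex. 3.14; Mumford, *Red Book* I §10] [folklore] -/
theorem _root_.Literature.AlgebraicGeometry.Motives.ComplexPoints.isClosed_pt (P : ComplexPoints X) : IsClosed ({P.pt} : Set X.left) := by
  have := isClosedImmersion_of_comp_eq_id _ _ P.toSpecHom_comp_hom
  have := P.toSpecHom.isClosedEmbedding.isClosed_range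
  rwa [Set.range_eq_singleton] at this
  exact fun x ↦ congr(P.toSpecHom $(Subsingleton.elim _ _))

variable (X)

/-- Complex points of a `ℂ`-scheme in Mathlib's spelling: `X(ℂ) ≃ {p : Spec ℂ ⟶ X // p ≫ f = 𝟙}`
(an `Over`-morphism from `Spec ℂ` is the same as a section of the structure map).
[Hartshorne II Ex. 2.7] [folklore] -/
def _root_.Literature.AlgebraicGeometry.Motives.ComplexPoints.homEquiv : ComplexPoints X ≃ {p : Spec (.of ℂ) ⟶ X.left // p ≫ X.hom = 𝟙 _} where
  toFun P := ⟨P.toSpecHom, P.toSpecHom_comp_hom⟩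
  invFun p := Literature.AlgebraicGeometry.Motives.AlgPoints.mk p.1 (by rw [p.2]; exact (specOver_self_hom ℂ).symm)
  left_inv P := by ext : 1; rfl
  right_inv p := rfl

/-- The underlying morphism of `homEquiv X P` is `P.toSpecHom`. [Hartshorne II Ex. 2.7] [folklore] -/
@[simp]
theorem _root_.Literature.AlgebraicGeometry.Motives.ComplexPoints.coe_homEquiv_apply (P : ComplexPoints X) : (ComplexPoints.homEquiv X P : Spec (.of ℂ) ⟶ X.left) =
    P.toSpecHom :=
  rfl

/-- For `X` locally of finite type over `ℂ`, complex points are in bijection with closed points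
(Hilbert's Nullstellensatz); this is Mathlib's `pointEquivClosedPoint` transported along
`homEquiv`. [Mumford, *Red Book* I §10; Hartshorne II Ex. 3.14] [folklore] -/
def _root_.Literature.AlgebraicGeometry.Motives.ComplexPoints.equivClosedPoints [LocallyOfFiniteType X.hom] : ComplexPoints X ≃ closedPoints X.left :=
  (ComplexPoints.homEquiv X).trans (pointEquivClosedPoint X.hom)

/-- `equivClosedPoints` sends `P` to its underlying (closed) point `P.pt`.
[Mumford, *Red Book* I §10] [folklore] -/
@[simp]
theorem _root_.Literature.AlgebraicGeometry.Motives.ComplexPoints.coe_equivClosedPoints_apply [LocallyOfFiniteType X.hom] (P : ComplexPoints X) :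
    (ComplexPoints.equivClosedPoints X P : X.left) = P.pt :=
  rfl

variable {X}

/-- For `X` locally of finite type over `ℂ`, the residue-field map `κ(P.pt) ⟶ ℂ` of a complex
point is Mathlib's Nullstellensatz isomorphism `residueFieldIsoBase` (both are inverse to
`ℂ → κ(P.pt)`). [Mumford, *Red Book* I §10] [folklore] -/
theorem _root_.Literature.AlgebraicGeometry.Motives.ComplexPoints.resHom_eq [LocallyOfFiniteType X.hom] (P : ComplexPoints X) :
    P.resHom = (residueFieldIsoBase X.hom P.pt P.isClosed_pt).hom := by
  refine ((residueFieldIsoBase X.hom P.pt P.isClosed_pt).inv_comp_eq.mp ?_).trans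
    (Category.comp_id _)
  rw [← Spec.map_injective.eq_iff, Spec.map_comp, Spec.map_id, SpecMap_residueFieldIsoBase_inv,
    ← Category.assoc]
  have : Spec.map P.resHom ≫ X.left.fromSpecResidueField P.pt = P.toSpecHom :=
    (X.left.SpecToEquivOfField ℂ).symm_apply_apply P.toSpecHom
  rw [this]
  exact P.toSpecHom_comp_hom

/-- For `X` locally of finite type over `ℂ`, the value of a regular function at a complex point is
given by the outline's formula `residueFieldIsoBase (X.evaluation U P.pt h s)`.
[Serre, GAGA §2; Mumford, *Red Book* I §10] [folklore] -/
theorem _root_.Literature.AlgebraicGeometry.Motives.ComplexPoints.eval_eq [LocallyOfFiniteType X.hom] (P : ComplexPoints X) (U : X.left.Opens)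
    (h : P.pt ∈ U) (s : Γ(X.left, U)) :
    P.eval U h s = (residueFieldIsoBase X.hom P.pt P.isClosed_pt).hom
      (X.left.evaluation U P.pt h s) := by
  simp only [Literature.AlgebraicGeometry.Motives.AlgPoints.eval, ComplexPoints.resHom_eq]

variable (X)

/-- `X(ℂ)` is connected iff `X` is, for `X` locally of finite type over `ℂ` (false over a
subfield: `Spec ℚ(i)` is connected with two complex points). [SGA1 XII Prop. 2.4; Serre, GAGA §2] [cite: SGA1, Exp. XII Prop. 2.4] [cite: SerreGAGA1956, §2] -/
def _root_.Literature.AlgebraicGeometry.Motives.ComplexPoints.connectedSpace_iff : Prop :=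
  ∀ [LocallyOfFiniteType X.hom],
    ConnectedSpace (ComplexPoints X) ↔ ConnectedSpace X.left

end OverComplex

/-! ### GAGA-type comparison of topological properties -/

section Subfield

variable {k : Type} [Field k] [Algebra k ℂ] (X : Literature.AlgebraicGeometry.Motives.SchemeOver k)

/-- For `X` locally of finite type over `k ⊆ ℂ`, `X(ℂ)` is Hausdorff iff `X` is separated over
`k`. The direction `←` is the accepted `Literature.t2Space_algPoints X ℂ`; `→` needs finite type (the
local scheme `Spec ℂ[t]_{(t)}` with doubled closed point is not separated but has discrete
`X(ℂ)`). [SGA1 XII Prop. 3.1 (viii); Serre, GAGA §2; Mumford, *Red Book* I §10] [cite: SGA1, Exp. XII Prop. 3.1 (viii)] -/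
def _root_.Literature.AlgebraicGeometry.Motives.ComplexPoints.t2Space_iff_isSeparated : Prop :=
  ∀ [LocallyOfFiniteType X.hom],
    T2Space (ComplexPoints X) ↔ IsSeparated X.hom

/-- If `X` is of finite type over `k ⊆ ℂ`, i.e. locally of finite type with quasi-compact
underlying space (`[CompactSpace X.left]` is a hypothesis on the *scheme*), then `X(ℂ)` is second
countable: a finite union of closed subspaces of some `ℂⁿ`. Quasi-compactness is needed (a
disjoint union of uncountably many points is locally of finite type). [Serre, GAGA §2;
SGA1 XII §1] [cite: SerreGAGA1956, §2] -/
def _root_.Literature.AlgebraicGeometry.Motives.ComplexPoints.secondCountableTopology_of_compactSpace : Prop :=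
  ∀ [LocallyOfFiniteType X.hom] [CompactSpace X.left],
    SecondCountableTopology (ComplexPoints X)

/-- For `X` separated and locally of finite type over `k ⊆ ℂ`, `X(ℂ)` is compact iff `X` is proper
over `k`. Separatedness is needed for `→`: the projective line with a doubled origin has compact
(non-Hausdorff) complex points but is not proper. The unconditional `←` is the accepted
`Literature.compactSpace_algPoints_of_isProper X ℂ`. [SGA1 XII Prop. 3.2 (v); Serre, GAGA §2 Prop. 6] [cite: SGA1, Exp. XII Prop. 3.2 (v)] [cite: SerreGAGA1956, §2 Prop. 6] -/
def _root_.Literature.AlgebraicGeometry.Motives.ComplexPoints.compactSpace_iff_isProper : Prop :=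
  ∀ [LocallyOfFiniteType X.hom] [IsSeparated X.hom],
    CompactSpace (ComplexPoints X) ↔ IsProper X.hom

end Subfield

end ComplexPoints

/-! ### The analytification predicate -/

section IsAnalytification

/-- `IsAnalytification E X d φ`: the map `φ : M → X(ℂ)` from a complex charted space `M` (modelled
on the finite-dimensional space `E`) exhibits `M` as the **analytification** `X^an` of the smooth
`k`-scheme `X` (`k ⊆ ℂ`) of relative dimension `d`: `φ` is a homeomorphism onto `X(ℂ)` with its
analytic topology, `finrank ℂ E = d`, and every regular function `s ∈ Γ(X, U)` on an affine open
`U` pulls back to a holomorphic function `s ∘ φ` on the open set `φ⁻¹(U(ℂ))`. By Osgood's theorem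
these conditions determine the complex structure when `M` carries a holomorphic atlas
(`IsAnalytification.unique`); the structure itself records only `ChartedSpace E M`. The model
space `E` is an explicit argument (it is not determined by `M`). Smoothness
`[SmoothOfRelativeDimension d X.hom]` is not a parameter of the predicate (no field uses it) but a
hypothesis of the theorems about it: consumers must add it themselves. For singular `X` the
predicate is not the right notion (the analytic space `X^an` is not a manifold).
[Serre, GAGA §2 (définition de `X^h`); SGA1 XII §1; Hartshorne App. B §1] [folklore] -/
structure IsAnalytification (E : Type*) [NormedAddCommGroup E] [NormedSpace ℂ E]
    [FiniteDimensional ℂ E] {M : Type*} [TopologicalSpace M] [ChartedSpace E M]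
    {k : Type} [Field k] [Algebra k ℂ] (X : Literature.AlgebraicGeometry.Motives.SchemeOver k) (d : ℕ) (φ : M → Literature.AlgebraicGeometry.Motives.ComplexPoints X) :
    Prop where
  /-- `φ` is a homeomorphism onto `X(ℂ)` with the analytic topology. -/
  isHomeomorph : IsHomeomorph φ
  /-- The model space has complex dimension the relative dimension of `X`. -/
  finrank_eq : Module.finrank ℂ E = d
  /-- Regular functions on affine opens pull back to holomorphic functions. -/
  mdifferentiableOn_evalOrZero : ∀ (U : X.left.affineOpens) (s : Γ(X.left, ↑U)),
    MDifferentiableOn 𝓘(ℂ, E) 𝓘(ℂ, ℂ)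
      (fun m ↦ Literature.AlgebraicGeometry.Motives.AlgPoints.evalOrZero (↑U : X.left.Opens) s (φ m))
      (φ ⁻¹' {P | P.pt ∈ (↑U : X.left.Opens)})

variable (E : Type*) [NormedAddCommGroup E] [NormedSpace ℂ E] [FiniteDimensional ℂ E]
  (E' : Type*) [NormedAddCommGroup E'] [NormedSpace ℂ E'] [FiniteDimensional ℂ E']
  {M : Type*} [TopologicalSpace M] [ChartedSpace E M]
  {M' : Type*} [TopologicalSpace M'] [ChartedSpace E' M']
  {k : Type} [Field k] [Algebra k ℂ] (X : Literature.AlgebraicGeometry.Motives.SchemeOver k) (d : ℕ) {Y : Literature.AlgebraicGeometry.Motives.SchemeOver k}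

namespace IsAnalytification

variable {E E' X d} {φ : M → Literature.AlgebraicGeometry.Motives.ComplexPoints X}

/-- The homeomorphism `M ≃ₜ X(ℂ)` underlying an analytification. [Serre, GAGA §2] [folklore] -/
def homeomorph (hφ : IsAnalytification E X d φ) : M ≃ₜ Literature.AlgebraicGeometry.Motives.ComplexPoints X :=
  hφ.isHomeomorph.homeomorph φ

/-- The underlying function of `hφ.homeomorph` is `φ`. [Serre, GAGA §2] [folklore] -/
@[simp]
theorem coe_homeomorph (hφ : IsAnalytification E X d φ) :
    (hφ.homeomorph : M → Literature.AlgebraicGeometry.Motives.ComplexPoints X) = φ :=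
  rfl

/-- The set `φ⁻¹(U(ℂ))` on which pulled-back regular functions live is open in `M`.
[Serre, GAGA §2] [folklore] -/
theorem isOpen_preimage (hφ : IsAnalytification E X d φ) (U : X.left.Opens) :
    IsOpen (φ ⁻¹' {P | P.pt ∈ U}) :=
  (Literature.AlgebraicGeometry.Motives.AlgPoints.isOpen_setOf_pt_mem U).preimage hφ.isHomeomorph.continuous

/-- Regular functions on *arbitrary* opens pull back to holomorphic functions on an
analytification (reduce to affine opens). [Serre, GAGA §2] [cite: SerreGAGA1956, §2] -/
def mdifferentiableOn_evalOrZero_opens : Prop :=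
  ∀ (hφ : IsAnalytification E X d φ) (U : X.left.Opens) (s : Γ(X.left, U)),
    MDifferentiableOn 𝓘(ℂ, E) 𝓘(ℂ, ℂ) (fun m ↦ Literature.AlgebraicGeometry.Motives.AlgPoints.evalOrZero U s (φ m))
      (φ ⁻¹' {P | P.pt ∈ U})

/-- An analytification of a separated `k`-scheme is Hausdorff. Relies on the accepted
`Literature.AlgebraicGeometry.Motives.t2Space_algPoints`. [SGA1 XII Prop. 3.1 (viii)] [folklore] -/
def t2Space : Prop :=
  ∀ [IsSeparated X.hom] (hφ : IsAnalytification E X d φ),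
    T2Space M

/- interim proof relied on results that are now named facts (D-0014); demoted to a fact by the M5 import, proof preserved:
:=
  haveI := t2Space_algPoints X ℂ
  hφ.homeomorph.symm.t2Space
-/

/-- An analytification of a proper `k`-scheme is compact. Relies on the accepted
`Literature.AlgebraicGeometry.Motives.compactSpace_algPoints_of_isProper`. [SGA1 XII Prop. 3.2 (v); Serre, GAGA §2 Prop. 6] [folklore] -/
def compactSpace : Prop :=
  ∀ [IsProper X.hom] (hφ : IsAnalytification E X d φ),
    CompactSpace M

/- interim proof relied on results that are now named facts (D-0014); demoted to a fact by the M5 import, proof preserved: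
:=
  haveI := compactSpace_algPoints_of_isProper X ℂ
  hφ.homeomorph.symm.compactSpace
-/

/-- An analytification of a `k`-scheme of finite type is second countable. Relies on
`ComplexPoints.secondCountableTopology_of_compactSpace`. [Serre, GAGA §2] [folklore] -/
def secondCountableTopology : Prop :=
  ∀ [LocallyOfFiniteType X.hom] [CompactSpace X.left] (hφ : IsAnalytification E X d φ),
    SecondCountableTopology M

/- interim proof relied on results that are now named facts (D-0014); demoted to a fact by the M5 import, proof preserved:
:=
  haveI := ComplexPoints.secondCountableTopology_of_compactSpace X
  hφ.homeomorph.secondCountableTopology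
-/

/-- **Uniqueness of the analytification.** Two analytifications `φ : M → X(ℂ)`, `ψ : M' → X(ℂ)`
of the same smooth `k`-scheme, both carrying holomorphic atlases, differ by a biholomorphism
`h : M ≃ₜ M'` with `ψ ∘ h = φ` (necessarily `h = ψ⁻¹ ∘ φ`, so `h` is unique; holomorphy by
Osgood's theorem: `h` is a homeomorphism holomorphic in local algebraic (étale) coordinates). The
`IsManifold` hypotheses are essential: `IsAnalytification` records only a `ChartedSpace`.
[Serre, GAGA §2 (unicité de `X^h`); SGA1 XII Thm. 1.1] [cite: SerreGAGA1956, §2 (unicité de X^h)] [cite: SGA1, Exp. XII Thm. 1.1] -/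
def unique : Prop :=
  ∀ [LocallyOfFiniteType X.hom] [SmoothOfRelativeDimension d X.hom] [IsManifold 𝓘(ℂ, E) ω M] [IsManifold 𝓘(ℂ, E') ω M'] {ψ : M' → Literature.AlgebraicGeometry.Motives.ComplexPoints X} (hφ : IsAnalytification E X d φ) (hψ : IsAnalytification E' X d ψ),
    ∃ h : M ≃ₜ M', MDifferentiable 𝓘(ℂ, E) 𝓘(ℂ, E') h ∧
      MDifferentiable 𝓘(ℂ, E') 𝓘(ℂ, E) h.symm ∧ ψ ∘ h = φ

/-- **Algebraic morphisms are holomorphic.** If `φ : M → X(ℂ)` and `ψ : M' → Y(ℂ)` are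
analytifications with holomorphic atlases and `g : X ⟶ Y` is a `k`-morphism, then the induced
map `h = ψ⁻¹ ∘ g(ℂ) ∘ φ : M → M'` (characterised by `ψ ∘ h = AlgPoints.map g ∘ φ`) is
holomorphic. [Serre, GAGA §2 (fonctorialité); SGA1 XII §1] [cite: SerreGAGA1956, §2 (fonctorialité)] -/
def mdifferentiable_comp_map : Prop :=
  ∀ [LocallyOfFiniteType X.hom] [LocallyOfFiniteType Y.hom] [SmoothOfRelativeDimension d X.hom] {e : ℕ} [SmoothOfRelativeDimension e Y.hom] [IsManifold 𝓘(ℂ, E) ω M] [IsManifold 𝓘(ℂ, E') ω M'] {ψ : M' → Literature.AlgebraicGeometry.Motives.ComplexPoints Y} (hφ : IsAnalytification E X d φ) (hψ : IsAnalytification E' Y e ψ) (g : X ⟶ Y) (h : M → M') (hh : ψ ∘ h = Literature.AlgebraicGeometry.Motives.AlgPoints.map g ∘ φ),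
    MDifferentiable 𝓘(ℂ, E) 𝓘(ℂ, E') h

end IsAnalytification

/-- **Existence of the analytification.** A smooth separated `k`-scheme `X` (`k ⊆ ℂ`) of relative
dimension `d`, locally of finite type, has an analytification: a Hausdorff complex manifold `M`
modelled on `ℂᵈ` (with a holomorphic atlas) and `φ : M → X(ℂ)` with
`IsAnalytification (Fin d → ℂ) X d φ` (locally `X` is étale over `𝔸ᵈ` and the implicit function
theorem gives holomorphic charts). Second countability is not bundled; it holds when `X` is
quasi-compact (`IsAnalytification.secondCountableTopology`).
[Serre, GAGA §2; SGA1 XII §1, Thm. 1.1; Hartshorne App. B §1] [cite: SerreGAGA1956, §2] -/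
def exists_isAnalytification : Prop :=
  ∀ [LocallyOfFiniteType X.hom] [SmoothOfRelativeDimension d X.hom] [IsSeparated X.hom],
    ∃ (M : Type) (_ : TopologicalSpace M) (_ : T2Space M) (_ : ChartedSpace (Fin d → ℂ) M)
      (_ : IsManifold 𝓘(ℂ, Fin d → ℂ) ω M) (φ : M → Literature.AlgebraicGeometry.Motives.ComplexPoints X),
      IsAnalytification (Fin d → ℂ) X d φ

end IsAnalytification

/-! ### Affine space -/

section Affine

/-- Affine space `𝔸^σ_k` as a `k`-scheme (Mathlib `AffineSpace` with its canonical structure map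
`𝔸(σ; Spec k) ↘ Spec k`); an abbreviation for the spelling used in the accepted
`Literature.AlgebraicGeometry.Motives.nonempty_algPoints_affineSpace_homeomorph`. [Hartshorne I §1, II Example 2.3.3] [folklore] -/
abbrev affineSpaceOver (σ : Type u) (k : Type u) [Field k] : Literature.AlgebraicGeometry.Motives.SchemeOver k :=
  Over.mk (𝔸(σ; Spec (.of k)) ↘ Spec (.of k))

/-- `𝔸^σ_k → Spec k` is locally of finite type for `σ` finite: Mathlib's instance, restated
because instance search does not unfold `(Over.mk f).hom`. [Hartshorne II Example 3.2.1] [folklore] -/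
instance locallyOfFiniteType_affineSpaceOver_hom (σ : Type u) [Finite σ] (k : Type u) [Field k] :
    LocallyOfFiniteType (affineSpaceOver σ k).hom :=
  inferInstanceAs <| LocallyOfFiniteType (𝔸(σ; Spec (.of k)) ↘ Spec (.of k))

/-- `𝔸^σ_k → Spec k` is separated (it is affine): Mathlib's instance, restated because instance
search does not unfold `(Over.mk f).hom`. [Hartshorne II Prop. 4.1] [folklore] -/
instance isSeparated_affineSpaceOver_hom (σ : Type u) (k : Type u) [Field k] :
    IsSeparated (affineSpaceOver σ k).hom :=
  inferInstanceAs <| IsSeparated (𝔸(σ; Spec (.of k)) ↘ Spec (.of k))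

/-- `𝔸^σ_k → Spec k` is smooth of relative dimension `#σ` for `σ` finite (Mathlib has
`LocallyOfFinitePresentation` for it, not yet smoothness). [Hartshorne III §10, Ex. 10.0.3] [cite: Hartshorne1977, III §10 Example 10.0.3] -/
def smoothOfRelativeDimension_affineSpace : Prop :=
  ∀ (σ : Type u) [Finite σ] (k : Type u) [Field k],
    SmoothOfRelativeDimension (Nat.card σ) (affineSpaceOver σ k).hom

/-- **`ℂᵈ` is the analytification of `𝔸ᵈ_ℂ`.** There is `φ : ℂᵈ → 𝔸ᵈ(ℂ)` (the inverse of the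
accepted homeomorphism `Literature.AlgebraicGeometry.Motives.nonempty_algPoints_affineSpace_homeomorph`, i.e. of Mathlib's
`AffineSpace.homOverEquiv` on points) which is an analytification for the trivial atlas
`chartedSpaceSelf ℂᵈ`, and which is compatible with coordinates: the `i`-th coordinate function
`AffineSpace.coord` takes the value `w i` at `φ w`. In the printed source this is §2 n°5
(pp. 8–9): Lemme 1 (a: the Zariski topology of `ℂⁿ` is coarser than the usual one; c: regular
functions on Zariski-open subsets are holomorphic) together with Prop. 2 and the Remarque following
it, in the case `X = ℂⁿ` (whose single algebraic chart is the identity); the paper has no item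
«§2 Exemple 1» (the locator used by an earlier version of this docstring). Proved below:
`exists_isAnalytification_affineSpace_holds`.
[Serre, GAGA §2 n°5, Lemme 1 and Prop. 2; Mumford, *Red Book* I §10]
[cite: SerreGAGA1956, §2 n°5 Lemme 1 and Prop. 2] -/
def exists_isAnalytification_affineSpace : Prop :=
  ∀ (d : ℕ),
    ∃ φ : (Fin d → ℂ) → Literature.AlgebraicGeometry.Motives.ComplexPoints (affineSpaceOver (Fin d) ℂ),
      IsAnalytification (Fin d → ℂ) (affineSpaceOver (Fin d) ℂ) d φ ∧
      ∀ (w : Fin d → ℂ) (i : Fin d),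
        Literature.AlgebraicGeometry.Motives.AlgPoints.evalOrZero ⊤ (AffineSpace.coord (Spec (.of ℂ)) i) (φ w) = w i

end Affine

/-! ### Projective space -/

section GradeZero

/-- For an internally graded `S`-algebra `R = ⨁ A i`, `S → A 0 → R` is a scalar tower (both maps
are the obvious inclusions). Mathlib has `SetLike.GradeZero.instAlgebra : Algebra S (A 0)` and
`Algebra (A 0) R` but not this compatibility (a Mathlib gap). [Bourbaki, *Algèbre* III §3] [folklore] -/
instance isScalarTower_gradeZero {ι S R : Type*} [AddMonoid ι] [CommSemiring S]
    [CommSemiring R] [Algebra S R] (A : ι → Submodule S R) [SetLike.GradedMonoid A] :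
    IsScalarTower S (A 0) R :=
  IsScalarTower.of_algebraMap_eq (fun _ ↦ rfl)

end GradeZero

section Proj

open Projectivization

attribute [local instance] MvPolynomial.gradedAlgebra

variable (σ : Type*) (k : Type u) [Field k]

/-- The degree-`0` part of `k[xᵢ | i ∈ σ]` consists of the constants: `algebraMap k (𝒜 0)` is
bijective for `𝒜 = MvPolynomial.homogeneousSubmodule σ k`. [Hartshorne II §2, Ex. 2.5.1] [folklore] -/
theorem algebraMap_homogeneousSubmodule_zero_bijective :
    Function.Bijective (algebraMap k (MvPolynomial.homogeneousSubmodule σ k 0)) := by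
  refine ⟨fun a b h ↦ by simpa using congrArg Subtype.val h, ?_⟩
  rintro ⟨p, hp⟩
  rw [MvPolynomial.mem_homogeneousSubmodule, ← MvPolynomial.totalDegree_zero_iff_isHomogeneous,
    MvPolynomial.totalDegree_eq_zero_iff_eq_C] at hp
  exact ⟨p.coeff 0, Subtype.ext (by simpa using hp.symm)⟩

/-- `k[xᵢ | i ∈ σ]` is of finite type over its degree-`0` part for `σ` finite (needed for
Mathlib's instances on `Proj.toSpecZero`). [Hartshorne II §2] [folklore] -/
instance finiteType_homogeneousSubmodule_zero [Finite σ] :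
    Algebra.FiniteType (MvPolynomial.homogeneousSubmodule σ k 0) (MvPolynomial σ k) :=
  Algebra.FiniteType.of_restrictScalars_finiteType k _ _

variable (n : ℕ)

/-- `Spec (𝒜 0) ⟶ Spec k` is an isomorphism (`𝒜 0 = k`) for `𝒜` the grading of
`k[x₀, …, xₙ]` (stated for `Fin (n + 1)`: `CommRingCat.ofHom` needs both rings in the universe
of `k`). [Hartshorne II §2, Ex. 2.5.1] [folklore] -/
instance isIso_specMap_algebraMap_homogeneousSubmodule_zero :
    IsIso (Spec.map (CommRingCat.ofHom
      (algebraMap k (MvPolynomial.homogeneousSubmodule (Fin (n + 1)) k 0)))) := by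
  have : IsIso (CommRingCat.ofHom
      (algebraMap k (MvPolynomial.homogeneousSubmodule (Fin (n + 1)) k 0))) := by
    rw [ConcreteCategory.isIso_iff_bijective]
    exact algebraMap_homogeneousSubmodule_zero_bijective (Fin (n + 1)) k
  infer_instance

/-- The underlying scheme of `Literature.projectiveSpace n k` is `Proj k[x₀, …, xₙ]` (definitional
unfolding). [Hartshorne II §2, Ex. 2.5.1] [folklore] -/
theorem projectiveSpace_left :
    (Literature.AlgebraicGeometry.Motives.projectiveSpace n k).left = Proj (MvPolynomial.homogeneousSubmodule (Fin (n + 1)) k) :=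
  rfl

/-- The structure morphism of `Literature.projectiveSpace n k` is `Proj.toSpecZero 𝒜 ≫ Spec (k → 𝒜 0)`
(definitional unfolding). [Hartshorne II §2, Ex. 2.5.1] [folklore] -/
theorem projectiveSpace_hom :
    (Literature.AlgebraicGeometry.Motives.projectiveSpace n k).hom =
      Proj.toSpecZero (MvPolynomial.homogeneousSubmodule (Fin (n + 1)) k) ≫
        Spec.map (CommRingCat.ofHom
          (algebraMap k (MvPolynomial.homogeneousSubmodule (Fin (n + 1)) k 0))) :=
  rfl

/-- `ℙⁿ_k ⟶ Spec k` is proper (Mathlib: `Proj.toSpecZero` is proper for `A` of finite type over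
`𝒜 0`, and `Spec (𝒜 0) ≅ Spec k`). In particular it is separated and locally of finite type.
This is a real instance; the accepted `IsSmoothProjective.isProper` is the general (deferred)
statement. [Hartshorne II Thm. 4.9] [folklore] -/
instance isProper_projectiveSpace_hom : IsProper (Literature.AlgebraicGeometry.Motives.projectiveSpace n k).hom := by
  -- `change` (not `rw`) so that the implicit source is `Proj 𝒜`, not `(projectiveSpace n k).left`
  change IsProper (Proj.toSpecZero (MvPolynomial.homogeneousSubmodule (Fin (n + 1)) k) ≫
    Spec.map (CommRingCat.ofHom
      (algebraMap k (MvPolynomial.homogeneousSubmodule (Fin (n + 1)) k 0))))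
  infer_instance

/-- `ℙⁿ_k ⟶ Spec k` is smooth of relative dimension `n` (the standard opens `D₊(xᵢ)` are affine
`n`-spaces); a field of the accepted `Literature.AlgebraicGeometry.Motives.isSmoothProjective_projectiveSpace`.
[Hartshorne III Thm. 10.1, II Ex. 2.14] [folklore] -/
def smoothOfRelativeDimension_projectiveSpace : Prop :=
  SmoothOfRelativeDimension n (Literature.AlgebraicGeometry.Motives.projectiveSpace n k).hom

/- interim proof relied on results that are now named facts (D-0014); demoted to a fact by the M5 import, proof preserved:
:=
  (isSmoothProjective_projectiveSpace k n).smoothOfRelativeDimension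
-/

/-- **`ℙⁿ(ℂ)` is the analytification of `ℙⁿ_ℂ`.** With the standard atlas of
`Literature.NumberTheory.Transcendental.ProjectiveSpace` on `ℙ ℂ ℂⁿ⁺¹`, there is
`φ : ℙ ℂ ℂⁿ⁺¹ → ℙⁿ_ℂ(ℂ)` (`[z₀ : ⋯ : zₙ] ↦` the point with these homogeneous coordinates) which is
an analytification of `Literature.projectiveSpace n ℂ`, and which is compatible with homogeneous
coordinates: for `F` homogeneous, `φ⁻¹(D₊(F)(ℂ))` is the complement of the projective zero locus
`Projectivization.projZeroLocus {F}` (membership in which is representative-independent since `F`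
is homogeneous, `Projectivization.mem_projZeroLocus_mk_iff`). For `F` homogeneous of degree `0`
both sides are `univ` or `∅`. In the printed source this is §2 n°5, Prop. 2 (p. 9: «Il existe
sur `X` une structure d'espace analytique et une seule telle que, pour toute carte `φ : V → U`, …
(Plus brièvement : toute carte algébrique doit être une carte analytique)») applied to the
algebraic charts `D₊(xᵢ) ≅ 𝔸ⁿ`, `[z] ↦ (zⱼ/zᵢ)ⱼ`, of `ℙⁿ`, which are the charts of the standard
atlas, together with Lemme 1 (p. 8) a) (the usual topology of `ℂⁿ` is finer than the Zariski
topology) and c) (regular functions are holomorphic); the paper has no item «§2 Exemple 2» (the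
locator used by an earlier version of this docstring).
[Serre, GAGA §2 n°5, Prop. 2 and Lemme 1; Mumford, *Red Book* I §10; Griffiths–Harris p. 15]
[cite: SerreGAGA1956, §2 n°5 Prop. 2 and Lemme 1] -/
def exists_isAnalytification_proj : Prop :=
  ∀ (n : ℕ),
    ∃ φ : ℙ ℂ (Fin (n + 1) → ℂ) → Literature.AlgebraicGeometry.Motives.ComplexPoints (Literature.AlgebraicGeometry.Motives.projectiveSpace n ℂ),
      IsAnalytification (Fin n → ℂ) (Literature.AlgebraicGeometry.Motives.projectiveSpace n ℂ) n φ ∧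
      ∀ (F : MvPolynomial (Fin (n + 1)) ℂ) (m : ℕ), F.IsHomogeneous m →
        φ ⁻¹' {P | P.pt ∈
          Proj.basicOpen (MvPolynomial.homogeneousSubmodule (Fin (n + 1)) ℂ) F} =
          (projZeroLocus {F})ᶜ

end Proj

/-! ### Open immersions on `L`-points: proofs

Proofs of `AlgPoints.range_map_of_isOpenImmersion` and `AlgPoints.isOpenEmbedding_map`
[SGA1 XII Thm. 1.1, proof a); Prop. 3.1 (xi)]: for an open immersion `φ : X ⟶ Y` of `k`-schemes
and any topological field `L`, `map φ : X(L) → Y(L)` is injective (`φ` is a monomorphism), has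
image `{Q | Q.pt ∈ φ(X)}` (a morphism `Spec L ⟶ Y` with image in `φ(X)` lifts along `φ`,
Mathlib `IsOpenImmersion.lift`), which is open (`isOpen_setOf_pt_mem`), and is inducing: the
sub-basic open `{P ∈ U(L) | f(P) ∈ V}` of `X(L)` is the preimage of the sub-basic open
`{Q ∈ φ(U)(L) | f'(Q) ∈ V}` of `Y(L)`, where `f' ∈ Γ(Y, φ(U))` corresponds to `f ∈ Γ(X, U)` under
Mathlib `Scheme.Hom.appIso`. -/

section AlgPoints
open Literature.AlgebraicGeometry.Motives (AlgPoints)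
open Literature.AlgebraicGeometry.Motives.AlgPoints

variable {k : Type u} [Field k] {X Y : Literature.AlgebraicGeometry.Motives.SchemeOver k} {L : Type u} [Field L] [Algebra k L]

/-- `map φ : X(L) → Y(L)` is injective when the underlying scheme morphism of `φ` is a
monomorphism (e.g. an immersion). [Hartshorne II Ex. 2.7] [folklore] -/
theorem _root_.Literature.AlgebraicGeometry.Motives.AlgPoints.map_injective (φ : X ⟶ Y) [Mono φ.left] :
    Function.Injective (map φ : AlgPoints X L → AlgPoints Y L) := by
  intro P Q h
  have h' := congrArg CommaMorphism.left h
  simp only [map, Over.comp_left, cancel_mono] at h'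
  ext : 1
  exact h'

/-- Transporting a regular function along an equality of opens does not change the sub-basic
sets it defines. [Mumford, *Red Book* I §10] [folklore] -/
theorem _root_.Literature.AlgebraicGeometry.Motives.AlgPoints.basicSet_map_eqToHom {U V : X.left.Opens} (e : U = V) (f : Γ(X.left, V)) (W : Set L) :
    basicSet U (X.left.presheaf.map (eqToHom e).op f) W = basicSet V f W := by
  subst e
  simp

/-- For an open immersion `φ : X ⟶ Y`, the sub-basic set `{P ∈ U(L) | f(P) ∈ V}` of `X(L)` is the
preimage under `map φ` of the sub-basic set of `Y(L)` attached to the open `φ(U) ⊆ Y` and the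
section `f' ∈ Γ(Y, φ(U))` corresponding to `f` (Mathlib `Scheme.Hom.appIso`).
[SGA1 XII Thm. 1.1, proof a)] [folklore] -/
theorem _root_.Literature.AlgebraicGeometry.Motives.AlgPoints.preimage_map_basicSet_image (φ : X ⟶ Y) [IsOpenImmersion φ.left] (U : X.left.Opens)
    (f : Γ(X.left, U)) (V : Set L) :
    map φ ⁻¹' (basicSet (φ.left ''ᵁ U) ((φ.left.appIso U).inv f) V : Set (AlgPoints Y L)) =
      basicSet U f V := by
  rw [preimage_map_basicSet, Scheme.Hom.appIso_inv_app_apply, basicSet_map_eqToHom]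

/-- An `L`-point of `Y` whose underlying point lies in the image of the open immersion
`φ : X ⟶ Y` lifts to an `L`-point of `X` (Mathlib `IsOpenImmersion.lift`, made into a
`k`-morphism). [SGA1 XII Thm. 1.1, proof a); Hartshorne II Ex. 2.7] [folklore] -/
def _root_.Literature.AlgebraicGeometry.Motives.AlgPoints.liftOfMemOpensRange (φ : X ⟶ Y) [IsOpenImmersion φ.left] (Q : AlgPoints Y L)
    (hQ : Q.pt ∈ φ.left.opensRange) : AlgPoints X L :=
  AlgPoints.mk
    (IsOpenImmersion.lift φ.left Q.toSpecHom (by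
      rintro _ ⟨y, rfl⟩
      obtain rfl : y = IsLocalRing.closedPoint L := Subsingleton.elim _ _
      exact hQ))
    (by rw [← Over.w φ, IsOpenImmersion.lift_fac_assoc]; exact Over.w Q)

/-- The lift of `Q` along `φ` maps to `Q`. [SGA1 XII Thm. 1.1, proof a)] [folklore] -/
@[simp]
theorem _root_.Literature.AlgebraicGeometry.Motives.AlgPoints.map_liftOfMemOpensRange (φ : X ⟶ Y) [IsOpenImmersion φ.left] (Q : AlgPoints Y L)
    (hQ : Q.pt ∈ φ.left.opensRange) : map φ (liftOfMemOpensRange φ Q hQ) = Q := by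
  ext : 1
  simp only [map, liftOfMemOpensRange, Over.comp_left, Over.homMk_left]
  exact IsOpenImmersion.lift_fac _ _ _

/-- **Discharge of `range_map_of_isOpenImmersion`.** The image of `X(L) → Y(L)` for an open
immersion `φ : X ⟶ Y` is `{Q | Q.pt ∈ φ(X)}`. [SGA1 XII Thm. 1.1, proof a)]
[cite: SGA1, Exp. XII Thm. 1.1, proof a)] -/
theorem _root_.Literature.AlgebraicGeometry.Motives.AlgPoints.range_map_of_isOpenImmersion_holds :
    range_map_of_isOpenImmersion (X := X) (Y := Y) (L := L) := by
  intro φ _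
  ext Q
  constructor
  · rintro ⟨P, rfl⟩
    exact ⟨P.pt, rfl⟩
  · intro hQ
    exact ⟨liftOfMemOpensRange φ Q hQ, map_liftOfMemOpensRange φ Q hQ⟩

variable [TopologicalSpace L]

/-- For an open immersion `φ : X ⟶ Y`, `map φ : X(L) → Y(L)` is inducing: the strong topology
of `X(L)` is induced from that of `Y(L)` (every sub-basic open of `X(L)` is the preimage of a
sub-basic open of `Y(L)`, `preimage_map_basicSet_image`). [SGA1 XII Thm. 1.1, proof a)] [folklore] -/
theorem _root_.Literature.AlgebraicGeometry.Motives.AlgPoints.isInducing_map (φ : X ⟶ Y) [IsOpenImmersion φ.left] :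
    IsInducing (map φ : AlgPoints X L → AlgPoints Y L) := by
  refine ⟨le_antisymm (continuous_map φ).le_induced ?_⟩
  refine TopologicalSpace.le_generateFrom_iff_subset_isOpen.mpr ?_
  rintro _ ⟨U, f, V, hV, rfl⟩
  exact isOpen_induced_iff.mpr ⟨_, isOpen_basicSet _ _ hV, preimage_map_basicSet_image φ U f V⟩

/-- For an open immersion `φ : X ⟶ Y`, `map φ : X(L) → Y(L)` is a topological embedding.
[SGA1 XII Thm. 1.1, proof a)] [folklore] -/
theorem _root_.Literature.AlgebraicGeometry.Motives.AlgPoints.isEmbedding_map (φ : X ⟶ Y) [IsOpenImmersion φ.left] :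
    IsEmbedding (map φ : AlgPoints X L → AlgPoints Y L) :=
  ⟨isInducing_map φ, map_injective φ⟩

/-- For an open immersion `φ : X ⟶ Y`, the image of `map φ : X(L) → Y(L)` is open in `Y(L)`
(it is `φ(X)(L)`). [SGA1 XII Thm. 1.1, proof a)] [folklore] -/
theorem _root_.Literature.AlgebraicGeometry.Motives.AlgPoints.isOpen_range_map (φ : X ⟶ Y) [IsOpenImmersion φ.left] :
    IsOpen (Set.range (map φ : AlgPoints X L → AlgPoints Y L)) := by
  rw [range_map_of_isOpenImmersion_holds φ]
  exact isOpen_setOf_pt_mem _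

/-- **Discharge of `isOpenEmbedding_map`** [SGA1 XII Thm. 1.1, proof a); Prop. 3.1 (xi)]: an open
immersion of `k`-schemes induces an open embedding `X(L) ↪ Y(L)` on `L`-points, for every
topological field `L`. [cite: SGA1, Exp. XII Prop. 3.1 (xi)]
[cite: SGA1, Exp. XII Thm. 1.1, proof a)] -/
theorem _root_.Literature.AlgebraicGeometry.Motives.AlgPoints.isOpenEmbedding_map_holds : isOpenEmbedding_map (X := X) (Y := Y) (L := L) := by
  intro φ _
  exact ⟨isEmbedding_map φ, isOpen_range_map φ⟩

end AlgPoints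

/-! ### `ℂᵈ` is the analytification of `𝔸ᵈ_ℂ`: proof of `exists_isAnalytification_affineSpace`

[Serre, GAGA §2 n°5, Lemme 1 and Prop. 2 with the Remarque following it, pp. 7–9]. The map
`φ : ℂᵈ → 𝔸ᵈ(ℂ)`, `w ↦ (Spec ℂ → Spec ℂ[x₁, …, x_d] ≅ 𝔸ᵈ_ℂ, xᵢ ↦ wᵢ)` (`AlgPoints.affinePoint`) is a
bijection with inverse `P ↦ (xᵢ(P))ᵢ` (`AlgPoints.affineCoords`; a morphism to `𝔸ᵈ` is determined
by the pull-backs of the coordinate functions, Mathlib `AffineSpace.hom_ext`). A regular function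
`s ∈ Γ(𝔸ᵈ, U)` is, on a basic open `D(g) ⊆ U` around a given point, of the form `p / gⁿ` with
`p, g ∈ Γ(𝔸ᵈ, ⊤) = ℂ[x₁, …, x_d]` (`Γ(𝔸ᵈ, D(g)) = ℂ[x][1/g]`, Mathlib
`IsAffineOpen.isLocalization_basicOpen`), and its value at `φ(w)` is `p(w) / g(w)ⁿ`
(`AlgPoints.exists_evalOrZero_affinePoint_eq_div`). Hence `s ∘ φ` is holomorphic on the open set
`φ⁻¹(U(ℂ))` — "un polynôme est une fonction holomorphe" (loc. cit., proof of Lemme 1) —, so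
`φ` is continuous for the strong topology (generated by the sets `{P ∈ U(ℂ) | s(P) ∈ V}`), and
`φ⁻¹` is continuous because the coordinates are global regular functions
(`ComplexPoints.affineHomeomorph`). -/

section AlgPoints
open Literature.AlgebraicGeometry.Motives (AlgPoints)
open Literature.AlgebraicGeometry.Motives.AlgPoints

variable {k : Type u} [Field k] {X : Literature.AlgebraicGeometry.Motives.SchemeOver k} {L : Type u} [Field L] [Algebra k L]

/-- The value of a global regular function `f ∈ Γ(X, ⊤)` at an `L`-point `P : Spec L → X` is the
element of `L = Γ(Spec L, ⊤)` obtained by pulling `f` back along `P` (Mathlib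
`Scheme.germ_stalkClosedPointTo`, `Scheme.residue_descResidueField`).
[Hartshorne II Ex. 2.7; Mumford, *Red Book* I §10] [folklore] -/
theorem _root_.Literature.AlgebraicGeometry.Motives.AlgPoints.eval_top (P : AlgPoints X L) (f : Γ(X.left, ⊤)) :
    P.eval ⊤ trivial f = (Scheme.ΓSpecIso (.of L)).hom (P.toSpecHom.appTop f) := by
  change (X.left.descResidueField (Scheme.stalkClosedPointTo P.left))
    ((X.left.presheaf.germ ⊤ _ trivial ≫ X.left.residue _) f) = _
  rw [CategoryTheory.comp_apply, ← CategoryTheory.comp_apply (X.left.residue _),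
    Scheme.residue_descResidueField, ← CategoryTheory.comp_apply,
    Scheme.germ_stalkClosedPointTo P.left ⊤ trivial]
  simp only [TopologicalSpace.Opens.map_top, eqToIso_refl, Iso.op_refl, Functor.mapIso_refl,
    Iso.refl_trans, CommRingCat.hom_comp, RingHom.coe_comp, Function.comp_apply]

/-- Evaluation at an `L`-point commutes with restriction of regular functions to smaller opens.
[Mumford, *Red Book* I §10] [folklore] -/
theorem _root_.Literature.AlgebraicGeometry.Motives.AlgPoints.eval_res (P : AlgPoints X L) {U V : X.left.Opens} (i : V ≤ U) (hV : P.pt ∈ V)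
    (f : Γ(X.left, U)) :
    P.eval V hV (X.left.presheaf.map (homOfLE i).op f) = P.eval U (i hV) f := by
  change P.resHom (((X.left.presheaf.map (homOfLE i).op ≫ X.left.presheaf.germ V P.pt hV) ≫
    X.left.residue _) f) = P.resHom ((X.left.presheaf.germ U P.pt (i hV) ≫ X.left.residue _) f)
  rw [TopCat.Presheaf.germ_res]

/-- Evaluation `f ↦ f(P)` of regular functions on `U ∋ P.pt` at the `L`-point `P`, as a ring
homomorphism `Γ(X, U) →+* L` (Mathlib `Scheme.evaluation` followed by `P.resHom : κ(P.pt) → L`).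
[Mumford, *Red Book* I §10] [folklore] -/
def _root_.Literature.AlgebraicGeometry.Motives.AlgPoints.evalRingHom (P : AlgPoints X L) (U : X.left.Opens) (h : P.pt ∈ U) : Γ(X.left, U) →+* L :=
  (X.left.evaluation U P.pt h ≫ P.resHom).hom

/-- `evalRingHom` is `AlgPoints.eval`. [Mumford, *Red Book* I §10] [folklore] -/
@[simp]
theorem _root_.Literature.AlgebraicGeometry.Motives.AlgPoints.evalRingHom_apply (P : AlgPoints X L) (U : X.left.Opens) (h : P.pt ∈ U)
    (f : Γ(X.left, U)) : P.evalRingHom U h f = P.eval U h f :=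
  rfl

/-- An `L`-point `P` of `U` lies in the basic open `D(f)`, `f ∈ Γ(X, U)`, iff `f(P) ≠ 0` (Mathlib
`Scheme.evaluation_ne_zero_iff_mem_basicOpen`, pushed along the embedding `κ(P.pt) ↪ L`).
[Hartshorne II §2; Mumford, *Red Book* I §10] [folklore] -/
theorem _root_.Literature.AlgebraicGeometry.Motives.AlgPoints.pt_mem_basicOpen_iff (P : AlgPoints X L) {U : X.left.Opens} (h : P.pt ∈ U)
    (f : Γ(X.left, U)) : P.pt ∈ X.left.basicOpen f ↔ P.eval U h f ≠ 0 := by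
  rw [← Scheme.evaluation_ne_zero_iff_mem_basicOpen _ _ h, AlgPoints.eval,
    map_ne_zero_iff _ P.resHom.hom.injective]

end AlgPoints

section AffineSpaceSections

/-- Global functions on affine space over `Spec R` are the polynomials over `R`:
`Γ(𝔸ⁿ_R, ⊤) ≅ R[xᵢ : i ∈ n]`, the isomorphism induced on global sections by Mathlib's
`AffineSpace.SpecIso n R : 𝔸(n; Spec R) ≅ Spec R[xᵢ]` followed by `Scheme.ΓSpecIso`; it sends the
coordinate function `AffineSpace.coord _ i` to `xᵢ` (`affineSpaceGlobalSectionsIso_hom_coord`).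
[Hartshorne II Example 2.3.3 & Prop. 2.2] [folklore] -/
def affineSpaceGlobalSectionsIso (n : Type u) (R : CommRingCat.{u}) :
    Γ(𝔸(n; Spec R), ⊤) ≅ CommRingCat.of (MvPolynomial n R) :=
  Scheme.Γ.mapIso (AffineSpace.SpecIso n R).symm.op ≪≫ Scheme.ΓSpecIso (.of (MvPolynomial n R))

/-- `affineSpaceGlobalSectionsIso` is "pull back along `Spec R[xᵢ] ≅ 𝔸ⁿ_R`, then identify
`Γ(Spec R[xᵢ], ⊤) = R[xᵢ]`". [Hartshorne II Prop. 2.2] [folklore] -/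
theorem affineSpaceGlobalSectionsIso_hom_apply (n : Type u) (R : CommRingCat.{u})
    (p : Γ(𝔸(n; Spec R), ⊤)) :
    (affineSpaceGlobalSectionsIso n R).hom p =
      (Scheme.ΓSpecIso (.of (MvPolynomial n R))).hom ((AffineSpace.SpecIso n R).inv.appTop p) :=
  rfl

/-- `affineSpaceGlobalSectionsIso` sends the `i`-th coordinate function to the variable `xᵢ`
(Mathlib `AffineSpace.SpecIso_inv_appTop_coord`). [Hartshorne II Example 2.3.3] [folklore] -/
theorem affineSpaceGlobalSectionsIso_hom_coord (n : Type u) (R : CommRingCat.{u}) (i : n) :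
    (affineSpaceGlobalSectionsIso n R).hom (AffineSpace.coord (Spec R) i) = MvPolynomial.X i := by
  rw [affineSpaceGlobalSectionsIso_hom_apply, AffineSpace.SpecIso_inv_appTop_coord]
  exact CommRingCat.hom_inv_apply _ _

end AffineSpaceSections

section AlgPoints
open Literature.AlgebraicGeometry.Motives (AlgPoints)
open Literature.AlgebraicGeometry.Motives.AlgPoints

variable {k : Type u} [Field k] {L : Type u} [Field L] [Algebra k L] {σ : Type u}

variable (k) in
/-- The `L`-point of affine space `𝔸^σ_k` with coordinates `w : σ → L`: the `k`-morphism
`Spec L → Spec k[xᵢ : i ∈ σ] ≅ 𝔸^σ_k` induced by the evaluation `k[xᵢ] → L`, `xᵢ ↦ wᵢ` (Mathlib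
`MvPolynomial.aeval w` and `AffineSpace.SpecIso`). It is the inverse of `P ↦ (xᵢ(P))ᵢ`
(`affineCoords_affinePoint`, `affinePoint_affineCoords`); for `k = L = ℂ` it is the chart
`ℂᵈ → 𝔸ᵈ(ℂ)` of [Serre, GAGA §2 n°5]. [Hartshorne II Ex. 2.7; Serre, GAGA §2 n°5] [folklore] -/
def _root_.Literature.AlgebraicGeometry.Motives.AlgPoints.affinePoint (w : σ → L) : AlgPoints (affineSpaceOver σ k) L :=
  AlgPoints.mk (Spec.map (CommRingCat.ofHom (MvPolynomial.aeval w).toRingHom) ≫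
      (AffineSpace.SpecIso σ (.of k)).inv) (by
    change (_ ≫ _) ≫ (𝔸(σ; Spec (.of k)) ↘ Spec (.of k)) = _
    rw [Category.assoc, AffineSpace.SpecIso_inv_over, ← Spec.map_comp, ← CommRingCat.ofHom_comp]
    congr 2
    ext c
    simp)

/-- The underlying scheme morphism of `affinePoint k w` is `Spec (xᵢ ↦ wᵢ)` followed by
`Spec k[xᵢ] ≅ 𝔸^σ_k`. [Hartshorne II Ex. 2.7] [folklore] -/
theorem _root_.Literature.AlgebraicGeometry.Motives.AlgPoints.affinePoint_left (w : σ → L) : (affinePoint k w).left =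
    Spec.map (CommRingCat.ofHom (MvPolynomial.aeval w).toRingHom) ≫
      (AffineSpace.SpecIso σ (.of k)).inv :=
  rfl

/-- The value of a global function `p ∈ Γ(𝔸^σ_k, ⊤) = k[xᵢ]` at the point with coordinates `w` is
`p(w)`. [Serre, GAGA §2 n°5; Mumford, *Red Book* I §10] [folklore] -/
theorem _root_.Literature.AlgebraicGeometry.Motives.AlgPoints.eval_top_affinePoint (w : σ → L) (p : Γ(𝔸(σ; Spec (.of k)), ⊤)) :
    (affinePoint k w).eval ⊤ trivial p =
      MvPolynomial.aeval w ((affineSpaceGlobalSectionsIso σ (.of k)).hom p) := by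
  rw [AlgPoints.eval_top, affineSpaceGlobalSectionsIso_hom_apply]
  change (Scheme.ΓSpecIso (.of L)).hom ((Spec.map _ ≫ _).appTop p) = _
  rw [Scheme.Hom.comp_appTop, CategoryTheory.comp_apply,
    ← CategoryTheory.comp_apply _ (Scheme.ΓSpecIso _).hom, Scheme.ΓSpecIso_naturality,
    CategoryTheory.comp_apply]
  rfl

/-- The `i`-th coordinate of `affinePoint k w` is `w i`. [Serre, GAGA §2 n°5] [folklore] -/
theorem _root_.Literature.AlgebraicGeometry.Motives.AlgPoints.evalOrZero_coord_affinePoint (w : σ → L) (i : σ) :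
    evalOrZero ⊤ (AffineSpace.coord (Spec (.of k)) i) (affinePoint k w) = w i := by
  rw [evalOrZero_of_mem _ (TopologicalSpace.Opens.mem_top _), eval_top_affinePoint,
    affineSpaceGlobalSectionsIso_hom_coord, MvPolynomial.aeval_X]

/-- `affinePoint k w` lies in the basic open `D(g)` of a global function `g` iff `g(w) ≠ 0`.
[Hartshorne II §2] [folklore] -/
theorem _root_.Literature.AlgebraicGeometry.Motives.AlgPoints.pt_affinePoint_mem_basicOpen_iff (w : σ → L) (g : Γ(𝔸(σ; Spec (.of k)), ⊤)) :
    (affinePoint k w).pt ∈ (𝔸(σ; Spec (.of k))).basicOpen g ↔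
      MvPolynomial.aeval w ((affineSpaceGlobalSectionsIso σ (.of k)).hom g) ≠ 0 := by
  rw [← eval_top_affinePoint]
  exact pt_mem_basicOpen_iff (affinePoint k w) (TopologicalSpace.Opens.mem_top _) g

/-- The coordinates `(xᵢ(P))ᵢ : σ → L` of an `L`-point `P` of affine space `𝔸^σ_k` (values at `P`
of the coordinate functions `AffineSpace.coord`; this is Mathlib's `AffineSpace.homOverEquiv` on
points followed by `Γ(Spec L, ⊤) = L`). [Hartshorne II Ex. 2.7; Serre, GAGA §2 n°5] [folklore] -/
def _root_.Literature.AlgebraicGeometry.Motives.AlgPoints.affineCoords (P : AlgPoints (affineSpaceOver σ k) L) : σ → L :=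
  fun i ↦ evalOrZero ⊤ (AffineSpace.coord (Spec (.of k)) i) P

/-- `affineCoords` is by definition the tuple of values of the coordinate functions. [folklore] -/
theorem _root_.Literature.AlgebraicGeometry.Motives.AlgPoints.affineCoords_apply (P : AlgPoints (affineSpaceOver σ k) L) (i : σ) :
    affineCoords P i = evalOrZero ⊤ (AffineSpace.coord (Spec (.of k)) i) P :=
  rfl

/-- The coordinates of the point with coordinates `w` are `w`. [Serre, GAGA §2 n°5] [folklore] -/
@[simp]
theorem _root_.Literature.AlgebraicGeometry.Motives.AlgPoints.affineCoords_affinePoint (w : σ → L) : affineCoords (affinePoint k w) = w :=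
  funext fun i ↦ evalOrZero_coord_affinePoint w i

/-- An `L`-point of affine space is the point with its coordinates (a morphism to `𝔸^σ` is
determined by its composite to the base and the pull-backs of the coordinates, Mathlib
`AffineSpace.hom_ext`). [Hartshorne II Ex. 2.7; Serre, GAGA §2 n°5] [folklore] -/
@[simp]
theorem _root_.Literature.AlgebraicGeometry.Motives.AlgPoints.affinePoint_affineCoords (P : AlgPoints (affineSpaceOver σ k) L) :
    affinePoint k (affineCoords P) = P := by
  apply Over.OverMorphism.ext
  apply AffineSpace.hom_ext
  · exact (Over.w (affinePoint k (affineCoords P))).trans (Over.w P).symm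
  · intro i
    have hinj : Function.Injective (Scheme.ΓSpecIso (.of L)).hom :=
      Function.LeftInverse.injective (g := (Scheme.ΓSpecIso (.of L)).inv)
        (CommRingCat.inv_hom_apply _)
    apply hinj
    change (Scheme.ΓSpecIso (.of L)).hom ((affinePoint k (affineCoords P)).toSpecHom.appTop _) =
      (Scheme.ΓSpecIso (.of L)).hom (P.toSpecHom.appTop _)
    rw [← eval_top, ← eval_top, eval_top_affinePoint, affineSpaceGlobalSectionsIso_hom_coord,
      MvPolynomial.aeval_X]
    exact evalOrZero_of_mem _ (TopologicalSpace.Opens.mem_top _)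

variable (k L σ) in
/-- The bijection `L^σ ≃ 𝔸^σ_k(L)`, `w ↦` the point with coordinates `w` (Mathlib
`AffineSpace.homOverEquiv` on `L`-points). [Hartshorne II Ex. 2.7; Serre, GAGA §2 n°5] [folklore] -/
@[simps]
def _root_.Literature.AlgebraicGeometry.Motives.AlgPoints.affinePointEquiv : (σ → L) ≃ AlgPoints (affineSpaceOver σ k) L where
  toFun := affinePoint k
  invFun := affineCoords
  left_inv := affineCoords_affinePoint
  right_inv := affinePoint_affineCoords

/-- The coordinate map `𝔸^σ_k(L) → L^σ` is continuous for the strong topology, for any topological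
field `L` (coordinates are global regular functions). [Serre, GAGA §2 n°5, Remarque] [folklore] -/
theorem _root_.Literature.AlgebraicGeometry.Motives.AlgPoints.continuous_affineCoords [TopologicalSpace L] :
    Continuous (affineCoords : AlgPoints (affineSpaceOver σ k) L → σ → L) :=
  continuous_pi fun _ ↦ continuous_evalOrZero_top _

/-- **Local form of a regular function on affine space.** If `s ∈ Γ(𝔸^σ_k, U)` and `D(g) ⊆ U` for a
global function `g`, there are a polynomial `p` and `n : ℕ` with `s(w) = p(w) / g(w)ⁿ` at every
`L`-point `w` with `g(w) ≠ 0` (`Γ(𝔸^σ, D(g)) = k[xᵢ][1/g]`, Mathlib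
`IsAffineOpen.isLocalization_basicOpen`). [Serre, GAGA §2 n°5, proof of Lemme 1; Hartshorne II
Prop. 2.2 (b)] [folklore] -/
theorem _root_.Literature.AlgebraicGeometry.Motives.AlgPoints.exists_evalOrZero_affinePoint_eq_div (U : (𝔸(σ; Spec (.of k))).Opens)
    (s : Γ(𝔸(σ; Spec (.of k)), U)) (g : Γ(𝔸(σ; Spec (.of k)), ⊤))
    (hgU : (𝔸(σ; Spec (.of k))).basicOpen g ≤ U) :
    ∃ (p : MvPolynomial σ k) (n : ℕ), ∀ w : σ → L,
      MvPolynomial.aeval w ((affineSpaceGlobalSectionsIso σ (.of k)).hom g) ≠ 0 →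
        evalOrZero U s (affinePoint k w) = MvPolynomial.aeval w p /
          MvPolynomial.aeval w ((affineSpaceGlobalSectionsIso σ (.of k)).hom g) ^ n := by
  obtain ⟨⟨p, ⟨_, n, rfl⟩⟩, hp⟩ := IsLocalization.surj (Submonoid.powers g)
    ((𝔸(σ; Spec (.of k))).presheaf.map (homOfLE hgU).op s :
      Γ(𝔸(σ; Spec (.of k)), (𝔸(σ; Spec (.of k))).basicOpen g))
  refine ⟨(affineSpaceGlobalSectionsIso σ (.of k)).hom p, n, fun w hw ↦ ?_⟩
  have hD : (affinePoint k w).pt ∈ (𝔸(σ; Spec (.of k))).basicOpen g :=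
    (pt_affinePoint_mem_basicOpen_iff w g).mpr hw
  have hle := (𝔸(σ; Spec (.of k))).basicOpen_le g
  have hp' : (affinePoint k w).eval _ hD
        ((𝔸(σ; Spec (.of k))).presheaf.map (homOfLE hgU).op s) *
      (affinePoint k w).eval _ hD
        ((𝔸(σ; Spec (.of k))).presheaf.map (homOfLE hle).op g) ^ n =
      (affinePoint k w).eval _ hD
        ((𝔸(σ; Spec (.of k))).presheaf.map (homOfLE hle).op p) := by
    have halg : algebraMap Γ(𝔸(σ; Spec (.of k)), ⊤)
        Γ(𝔸(σ; Spec (.of k)), (𝔸(σ; Spec (.of k))).basicOpen g) =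
        ((𝔸(σ; Spec (.of k))).presheaf.map (homOfLE hle).op).hom :=
      RingHom.algebraMap_toAlgebra _
    rw [halg, map_pow] at hp
    rw [← evalRingHom_apply, ← evalRingHom_apply, ← evalRingHom_apply, ← map_pow, ← map_mul]
    exact congrArg ((affinePoint k w).evalRingHom _ hD) hp
  have e1 : (affinePoint k w).eval _ hD
      ((𝔸(σ; Spec (.of k))).presheaf.map (homOfLE hgU).op s) =
      evalOrZero U s (affinePoint k w) :=
    ((affinePoint k w).eval_res hgU hD s).trans
      (evalOrZero_of_mem (X := affineSpaceOver σ k) s (hgU hD)).symm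
  have e2 : ∀ f : Γ(𝔸(σ; Spec (.of k)), ⊤), (affinePoint k w).eval _ hD
      ((𝔸(σ; Spec (.of k))).presheaf.map (homOfLE hle).op f) =
      MvPolynomial.aeval w ((affineSpaceGlobalSectionsIso σ (.of k)).hom f) :=
    fun f ↦ ((affinePoint k w).eval_res hle hD f).trans (eval_top_affinePoint w f)
  rw [e1, e2, e2] at hp'
  rw [eq_div_iff (pow_ne_zero n hw), hp']

end AlgPoints

section ComplexPoints
open Literature.AlgebraicGeometry.Motives (ComplexPoints)
open Literature.AlgebraicGeometry.Motives.ComplexPoints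

open MvPolynomial

variable (d : ℕ)

/-- Over `ℂ`, the value `p(w)` of `eval_top_affinePoint` is polynomial evaluation
`MvPolynomial.eval w`. [Serre, GAGA §2 n°5] [folklore] -/
theorem _root_.Literature.AlgebraicGeometry.Motives.ComplexPoints.eval_top_affinePoint (w : Fin d → ℂ) (p : Γ(𝔸(Fin d; Spec (.of ℂ)), ⊤)) :
    (Literature.AlgebraicGeometry.Motives.AlgPoints.affinePoint ℂ w).eval ⊤ trivial p =
      MvPolynomial.eval w ((affineSpaceGlobalSectionsIso (Fin d) (.of ℂ)).hom p) :=
  Literature.AlgebraicGeometry.Motives.AlgPoints.eval_top_affinePoint w p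

/-- Over `ℂ`: `affinePoint ℂ w ∈ D(g) ↔ g(w) ≠ 0` with polynomial evaluation `MvPolynomial.eval`.
[Serre, GAGA §2 n°5] [folklore] -/
theorem _root_.Literature.AlgebraicGeometry.Motives.ComplexPoints.pt_affinePoint_mem_basicOpen_iff (w : Fin d → ℂ) (g : Γ(𝔸(Fin d; Spec (.of ℂ)), ⊤)) :
    (Literature.AlgebraicGeometry.Motives.AlgPoints.affinePoint ℂ w).pt ∈ (𝔸(Fin d; Spec (.of ℂ))).basicOpen g ↔
      MvPolynomial.eval w ((affineSpaceGlobalSectionsIso (Fin d) (.of ℂ)).hom g) ≠ 0 :=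
  Literature.AlgebraicGeometry.Motives.AlgPoints.pt_affinePoint_mem_basicOpen_iff w g

/-- `U(ℂ)` pulled back to `ℂᵈ`, i.e. `{w | φ(w) ∈ U}`, is open in the usual topology of `ℂᵈ`: it is
covered by the sets `{w | g(w) ≠ 0}`, `D(g) ⊆ U`. This is [Serre, GAGA §2 n°5, Lemme 1 a)] (the
Zariski topology of `ℂⁿ` is coarser than the usual one). [cite: SerreGAGA1956, §2 n°5 Lemme 1 a)] -/
theorem _root_.Literature.AlgebraicGeometry.Motives.ComplexPoints.isOpen_setOf_pt_affinePoint_mem (U : (𝔸(Fin d; Spec (.of ℂ))).Opens) :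
    IsOpen {w : Fin d → ℂ | (Literature.AlgebraicGeometry.Motives.AlgPoints.affinePoint ℂ w).pt ∈ U} := by
  rw [isOpen_iff_forall_mem_open]
  intro w₀ hw₀
  obtain ⟨_, ⟨_, ⟨g, rfl⟩, rfl⟩, hxg, hgU⟩ :=
    (isBasis_basicOpen 𝔸(Fin d; Spec (.of ℂ))).exists_subset_of_mem_open hw₀ U.isOpen
  refine ⟨{w | MvPolynomial.eval w ((affineSpaceGlobalSectionsIso (Fin d) (.of ℂ)).hom g) ≠ 0},
    fun w hw ↦ hgU ?_, isOpen_ne_fun (MvPolynomial.continuous_eval _) continuous_const, ?_⟩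
  · exact (pt_affinePoint_mem_basicOpen_iff d w g).mpr hw
  · exact (pt_affinePoint_mem_basicOpen_iff d w₀ g).mp hxg

/-- **Regular functions on `𝔸ᵈ_ℂ` are holomorphic** [Serre, GAGA §2 n°5, Lemme 1 c)]: for
`s ∈ Γ(𝔸ᵈ_ℂ, U)`, the function `w ↦ s(φ(w))` is complex differentiable on the open set
`{w | φ(w) ∈ U} ⊆ ℂᵈ` (locally it is a rational function `p / gⁿ` with `g ≠ 0`,
`AlgPoints.exists_evalOrZero_affinePoint_eq_div`). [cite: SerreGAGA1956, §2 n°5 Lemme 1 c)] -/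
theorem _root_.Literature.AlgebraicGeometry.Motives.ComplexPoints.differentiableOn_evalOrZero_affinePoint (U : (𝔸(Fin d; Spec (.of ℂ))).Opens)
    (s : Γ(𝔸(Fin d; Spec (.of ℂ)), U)) :
    DifferentiableOn ℂ (fun w ↦ Literature.AlgebraicGeometry.Motives.AlgPoints.evalOrZero U s (Literature.AlgebraicGeometry.Motives.AlgPoints.affinePoint ℂ w))
      {w : Fin d → ℂ | (Literature.AlgebraicGeometry.Motives.AlgPoints.affinePoint ℂ w).pt ∈ U} := by
  intro w₀ hw₀
  obtain ⟨_, ⟨_, ⟨g, rfl⟩, rfl⟩, hxg, hgU⟩ :=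
    (isBasis_basicOpen 𝔸(Fin d; Spec (.of ℂ))).exists_subset_of_mem_open hw₀ U.isOpen
  obtain ⟨p, n, hpn⟩ := Literature.AlgebraicGeometry.Motives.AlgPoints.exists_evalOrZero_affinePoint_eq_div (L := ℂ) U s g hgU
  set q : MvPolynomial (Fin d) ℂ := (affineSpaceGlobalSectionsIso (Fin d) (.of ℂ)).hom g with hq
  have hO : IsOpen {w : Fin d → ℂ | MvPolynomial.eval w q ≠ 0} :=
    isOpen_ne_fun (MvPolynomial.continuous_eval _) continuous_const
  have hw₀' : MvPolynomial.eval w₀ q ≠ 0 := (pt_affinePoint_mem_basicOpen_iff d w₀ g).mp hxg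
  have hdiff : DifferentiableOn ℂ
      (fun w ↦ MvPolynomial.eval w p / MvPolynomial.eval w q ^ n)
      {w : Fin d → ℂ | MvPolynomial.eval w q ≠ 0} :=
    (AnalyticOnNhd.div ((AnalyticOnNhd.eval_mvPolynomial p).mono (Set.subset_univ _))
      (((AnalyticOnNhd.eval_mvPolynomial q).mono (Set.subset_univ _)).fun_pow n)
      fun w hw ↦ pow_ne_zero n hw).differentiableOn
  have hdiff' : DifferentiableOn ℂ
      (fun w ↦ Literature.AlgebraicGeometry.Motives.AlgPoints.evalOrZero U s (Literature.AlgebraicGeometry.Motives.AlgPoints.affinePoint ℂ w))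
      {w : Fin d → ℂ | MvPolynomial.eval w q ≠ 0} :=
    hdiff.congr fun w hw ↦ hpn w hw
  exact (hdiff'.differentiableAt (hO.mem_nhds hw₀')).differentiableWithinAt

/-- The chart `φ : ℂᵈ → 𝔸ᵈ(ℂ)` is continuous for the strong topology: the sub-basic open
`{P ∈ U(ℂ) | s(P) ∈ V}` pulls back to the preimage of the open `V` under the continuous function
`s ∘ φ` on the open set `{w | φ(w) ∈ U}`. [Serre, GAGA §2 n°5, Lemme 1 c) & Remarque]
[cite: SerreGAGA1956, §2 n°5 Lemme 1] -/
theorem _root_.Literature.AlgebraicGeometry.Motives.ComplexPoints.continuous_affinePoint :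
    Continuous
      (Literature.AlgebraicGeometry.Motives.AlgPoints.affinePoint ℂ : (Fin d → ℂ) → ComplexPoints (affineSpaceOver (Fin d) ℂ)) := by
  refine continuous_generateFrom_iff.mpr ?_
  rintro _ ⟨U, f, V, hV, rfl⟩
  rw [Literature.AlgebraicGeometry.Motives.AlgPoints.basicSet_eq_setOf]
  exact (differentiableOn_evalOrZero_affinePoint d U f).continuousOn.isOpen_inter_preimage
    (isOpen_setOf_pt_affinePoint_mem d U) hV

/-- **`𝔸ᵈ(ℂ)` with its strong topology is `ℂᵈ`**: the homeomorphism `ℂᵈ ≃ₜ 𝔸ᵈ(ℂ)`, `w ↦` the point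
with coordinates `w`, with inverse the coordinate map. [Serre, GAGA §2 n°5, Lemme 1 & Remarque;
Mumford, *Red Book* I §10] [cite: SerreGAGA1956, §2 n°5 Lemme 1] -/
def _root_.Literature.AlgebraicGeometry.Motives.ComplexPoints.affineHomeomorph : (Fin d → ℂ) ≃ₜ ComplexPoints (affineSpaceOver (Fin d) ℂ) where
  toEquiv := Literature.AlgebraicGeometry.Motives.AlgPoints.affinePointEquiv ℂ ℂ (Fin d)
  continuous_toFun := continuous_affinePoint d
  continuous_invFun := Literature.AlgebraicGeometry.Motives.AlgPoints.continuous_affineCoords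

/-- The underlying map of `affineHomeomorph d` is `AlgPoints.affinePoint ℂ`. [folklore] -/
@[simp]
theorem _root_.Literature.AlgebraicGeometry.Motives.ComplexPoints.coe_affineHomeomorph :
    (ComplexPoints.affineHomeomorph d : (Fin d → ℂ) → ComplexPoints (affineSpaceOver (Fin d) ℂ)) =
      Literature.AlgebraicGeometry.Motives.AlgPoints.affinePoint ℂ :=
  rfl

/-- The inverse of `affineHomeomorph d` is the coordinate map `AlgPoints.affineCoords`.
[folklore] -/
@[simp]
theorem _root_.Literature.AlgebraicGeometry.Motives.ComplexPoints.coe_affineHomeomorph_symm :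
    ((ComplexPoints.affineHomeomorph d).symm : ComplexPoints (affineSpaceOver (Fin d) ℂ) → Fin d → ℂ) =
      Literature.AlgebraicGeometry.Motives.AlgPoints.affineCoords :=
  rfl

end ComplexPoints

/-- **Discharge of `exists_isAnalytification_affineSpace`: `ℂᵈ` is the analytification of `𝔸ᵈ_ℂ`.**
The chart `φ = AlgPoints.affinePoint ℂ : ℂᵈ → 𝔸ᵈ(ℂ)` (`w ↦` the complex point with coordinates
`w`) is a homeomorphism for the strong topology (`ComplexPoints.affineHomeomorph`), regular
functions pull back to holomorphic functions along it
(`ComplexPoints.differentiableOn_evalOrZero_affinePoint`), and the `i`-th coordinate function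
takes the value `w i` at `φ w` (`AlgPoints.evalOrZero_coord_affinePoint`). This is
[Serre, GAGA §2 n°5]: Lemme 1 (a: the Zariski topology of `ℂⁿ` is coarser than the usual one;
c: regular maps are holomorphic, "un polynôme est une fonction holomorphe") together with
Prop. 2 and the Remarque following it (the topology of `X^h` is the coarsest making the regular
functions on Zariski opens continuous), in the case `X = ℂⁿ` — the locator "Exemple 1" in the
docstring of the fact refers to this case; the paper has no numbered examples.
[cite: SerreGAGA1956, §2 n°5 Lemme 1 & Prop. 2 (pp. 7–9)] -/
theorem exists_isAnalytification_affineSpace_holds : exists_isAnalytification_affineSpace := by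
  intro d
  refine ⟨Literature.AlgebraicGeometry.Motives.AlgPoints.affinePoint ℂ, ⟨(Literature.AlgebraicGeometry.Motives.ComplexPoints.affineHomeomorph d).isHomeomorph,
    Module.finrank_fin_fun ℂ, fun U s ↦ ?_⟩, Literature.AlgebraicGeometry.Motives.AlgPoints.evalOrZero_coord_affinePoint⟩
  exact mdifferentiableOn_iff_differentiableOn.mpr
    (Literature.AlgebraicGeometry.Motives.ComplexPoints.differentiableOn_evalOrZero_affinePoint d U.1 s)

end Literature.NumberTheory.Transcendental
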